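import Summits.RiemannHypothesis.RiemannHypothesis.Theorems.PfPersistenceM2UpperLawCount
import HarnessLib

/-!
# M2 upper half (2/7): the raw prolate witness at the zeros and the one prolate input (H-LEAK-L1)

pub-rhpf cell (M2 seat, generation 3) — part 2 of 7 of the M2 UPPER-HALF packet.  HONEST FRAMING:
long-odds MECHANISM SEARCH; no RH claims.  Everything in this file is PROVED (kernel-checked, RH-free) or an
explicitly named `def … : Prop` taken as an argument; nothing here implies or assumes RH.  The packet's
headline and full ledger are in `PfPersistenceM2UpperLeak.lean` (part 7):
`ProlateLeakL1 A p Λ` (ONE RH-free prolate leak bound, exponent `p`) + two named literature facts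
⇒ `ConnesLawUpperWitnessWith (2p + 1 + δ)` ⇒ `ConnesLawUpperWith (2p + 1 + δ)` ⇒ `ConnesLawUpper`.

This part:
* §D (PROVED) symmetry / measurability / positivity facts for the tree's prolate interface
  `IsProlateFunction` (evenness by Sturm–Liouville uniqueness `existsUnique_isProlateFunction`, named fact).
* §E (PROVED) Connes's guess transported to the additive variable, `k₀(t) = 𝓔(h_λ)(e^t)·1_{|t| ≤ log λ}`
  (`leakRaw`): `weilMellin k₀ s = M_λ(s − ½)` (`prolateGuessMellin`, substitution `u = e^t`), and at every
  non-trivial zero — on the line or not — `‖k̂₀(ρ)‖ ≤ ∫_{(0,λ⁻¹]} |𝓔(h_λ)(u)| u^{Re ρ − 3/2} du`, because in the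
  truncation identity `prolateGuessMellin_eq` the main term `ζ(s+½)·𝓜h_λ` dies at every zero.
* §F THE ONE INPUT, typed: `ProlateLeakL1 A p Λ` (H-LEAK-L1, `@[conjecture]` = open obligation node; RH-free;
  paper-proved with `p = 9/2` in the connes-x13 bundle, THEOREM E′, not formalised) and the leak bound it
  gives at the zeros, `‖k̂₀(ρ)‖ ≤ A N^p e^{-2πN}/Re ρ ≤ (A/c₀) N^p e^{-2πN} log(|γ|+4)` (`λ² = N`).

References: A. Connes, letter (2026) §6 (6.4)–(6.6); Connes–Consani–Moscovici (2025) §7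
[ConnesConsaniMoscovici2025]; connes-x13 bundle `papers/RiemannHypothesis/connes-x13` PROOF-ATTEMPT §3.6.
-/

noncomputable section

set_option linter.dupNamespace false  -- the mandated namespace repeats `RiemannHypothesis`

open Complex Filter Set Topology Metric MeasureTheory
open Literature.NumberTheory.LFunctions
open scoped ComplexConjugate Convolution

namespace Summit.RiemannHypothesis.RiemannHypothesis.Theorems.PfPersistenceM2Leak

/-! ## §D The prolate functions: symmetry facts from the tree's interface

`IsProlateFunction` does not list evenness; it follows from uniqueness (`existsUnique_isProlateFunction`, the
named Slepian–Pollak fact) because `x ↦ f(−x)` satisfies the same interface.  Positivity of `∫ h_{0,λ}`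
follows from "no zeros in `(−λ, λ)`" and `h_{0,λ}(0) > 0`. -/

section Prolate

variable {lam : ℝ} {n : ℕ} {f : ℝ → ℝ}

/-- The reflected function `x ↦ f(−x)` is again a prolate function with the same parameters. -/
theorem isProlateFunction_comp_neg (hf : IsProlateFunction lam n f) :
    IsProlateFunction lam n (fun x ↦ f (-x)) where
  lam_pos := hf.lam_pos
  contDiffOn := hf.contDiffOn.comp contDiff_neg.contDiffOn fun x hx ↦ by
    simp only [mem_Icc] at hx ⊢; constructor <;> linarith [hx.1, hx.2]
  eigen := by
    obtain ⟨χ, hχ⟩ := hf.eigen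
    refine ⟨χ, fun x hx ↦ ?_⟩
    set g : ℝ → ℝ := fun y ↦ (lam ^ 2 - y ^ 2) * deriv f y with hg
    have h1 : (fun y ↦ (lam ^ 2 - y ^ 2) * deriv (fun z ↦ f (-z)) y) = fun y ↦ -(g (-y)) := by
      funext y
      rw [deriv_comp_neg]
      simp only [hg]; ring
    have h2 : deriv (fun y ↦ -(g (-y))) x = deriv g (-x) := by
      rw [show (fun y ↦ -(g (-y))) = -(fun y ↦ g (-y)) from rfl, deriv.neg, deriv_comp_neg, neg_neg]
    rw [h1, h2]
    have hx' : -x ∈ Ioo (-lam) lam := by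
      simp only [mem_Ioo] at hx ⊢; constructor <;> linarith [hx.1, hx.2]
    have := hχ (-x) hx'
    simp only [hg] at this ⊢
    have e : (2 * Real.pi * lam * x) ^ 2 = (2 * Real.pi * lam * (-x)) ^ 2 := by ring
    rw [e]
    exact this
  support := fun x hx ↦ hf.support (-x) (by rwa [abs_neg])
  zeros_finite := by
    have hset : {x : ℝ | x ∈ Ioo (-lam) lam ∧ f (-x) = 0} =
        (fun x ↦ -x) '' {x : ℝ | x ∈ Ioo (-lam) lam ∧ f x = 0} := by
      ext x
      simp only [mem_setOf_eq, mem_image, mem_Ioo]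
      constructor
      · rintro ⟨⟨h1, h2⟩, h3⟩
        exact ⟨-x, ⟨⟨by linarith, by linarith⟩, h3⟩, neg_neg x⟩
      · rintro ⟨y, ⟨⟨h1, h2⟩, h3⟩, rfl⟩
        exact ⟨⟨by linarith, by linarith⟩, by rwa [neg_neg]⟩
    rw [hset]
    exact hf.zeros_finite.image _
  zeros_card := by
    have hset : {x : ℝ | x ∈ Ioo (-lam) lam ∧ f (-x) = 0} =
        (fun x ↦ -x) '' {x : ℝ | x ∈ Ioo (-lam) lam ∧ f x = 0} := by
      ext x
      simp only [mem_setOf_eq, mem_image, mem_Ioo]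
      constructor
      · rintro ⟨⟨h1, h2⟩, h3⟩
        exact ⟨-x, ⟨⟨by linarith, by linarith⟩, h3⟩, neg_neg x⟩
      · rintro ⟨y, ⟨⟨h1, h2⟩, h3⟩, rfl⟩
        exact ⟨⟨by linarith, by linarith⟩, by rwa [neg_neg]⟩
    rw [hset, Set.ncard_image_of_injective _ neg_injective, hf.zeros_card]
  norm_one := by
    have h := hf.norm_one
    have h2 : (∫ x in (-lam)..lam, (fun y ↦ f y ^ 2) (-x)) = ∫ x in (-lam)..lam, (fun y ↦ f y ^ 2) x := by
      rw [intervalIntegral.integral_comp_neg (fun y ↦ f y ^ 2), neg_neg]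
    simpa using h2.trans h
  pos_zero := by simpa using hf.pos_zero

/-- **Prolate functions of even index are even** (from uniqueness, `existsUnique_isProlateFunction`). -/
theorem isProlateFunction_even (hE : existsUnique_isProlateFunction) (hn : Even n)
    (hf : IsProlateFunction lam n f) (x : ℝ) : f (-x) = f x := by
  obtain ⟨g, -, hg⟩ := hE lam hf.lam_pos n hn
  have h1 : (fun y ↦ f (-y)) = g := hg _ (isProlateFunction_comp_neg hf)
  have h2 : f = g := hg _ hf
  have := congrFun h1 x
  rw [this, ← h2]

/-- A prolate function is measurable (it is `C²` on `[−λ, λ]` and vanishes outside). -/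
theorem isProlateFunction_measurable (hf : IsProlateFunction lam n f) : Measurable f := by
  classical
  have heq : f = (Icc (-lam) lam).piecewise f 0 := by
    funext x
    by_cases hx : x ∈ Icc (-lam) lam
    · rw [Set.piecewise_eq_of_mem _ _ _ hx]
    · rw [Set.piecewise_eq_of_notMem _ _ _ hx, Pi.zero_apply]
      refine hf.support x ?_
      simp only [mem_Icc, not_and_or, not_le] at hx
      rcases hx with hx | hx
      · rw [abs_of_neg (by linarith [hf.lam_pos])]; linarith
      · rw [abs_of_pos (by linarith [hf.lam_pos])]; exact hx
  rw [heq]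
  exact hf.contDiffOn.continuousOn.measurable_piecewise continuousOn_const measurableSet_Icc

/-- `h_{0,λ} > 0` on `(−λ, λ)`: no zeros there, `h_{0,λ}(0) > 0`, continuity. -/
theorem isProlateFunction_pos_of_mem_Ioo (hf : IsProlateFunction lam 0 f) {x : ℝ}
    (hx : x ∈ Ioo (-lam) lam) : 0 < f x := by
  have hlam := hf.lam_pos
  have hempty : {y : ℝ | y ∈ Ioo (-lam) lam ∧ f y = 0} = ∅ :=
    (Set.ncard_eq_zero hf.zeros_finite).1 hf.zeros_card
  have hnz : ∀ y ∈ Ioo (-lam) lam, f y ≠ 0 := fun y hy hy0 ↦ by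
    have : y ∈ {y : ℝ | y ∈ Ioo (-lam) lam ∧ f y = 0} := ⟨hy, hy0⟩
    rw [hempty] at this
    exact this
  by_contra hneg
  push Not at hneg
  -- intermediate value on the segment between `0` and `x`
  have hseg : uIcc 0 x ⊆ Ioo (-lam) lam := by
    intro y hy
    rw [mem_uIcc] at hy
    simp only [mem_Ioo] at hx ⊢
    rcases hy with ⟨h1, h2⟩ | ⟨h1, h2⟩ <;> constructor <;> linarith
  have hcont : ContinuousOn f (uIcc 0 x) :=
    hf.contDiffOn.continuousOn.mono (hseg.trans Ioo_subset_Icc_self)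
  have hconn := isPreconnected_uIcc.intermediate_value (right_mem_uIcc) (left_mem_uIcc) hcont
  have h0mem : (0 : ℝ) ∈ Icc (f x) (f 0) := ⟨hneg, hf.pos_zero.le⟩
  obtain ⟨c, hc, hfc⟩ := hconn h0mem
  exact hnz c (hseg hc) hfc

/-- `∫_{−λ}^{λ} h_{0,λ} > 0`. -/
theorem isProlateFunction_integral_pos (hf : IsProlateFunction lam 0 f) :
    0 < ∫ x in (-lam)..lam, f x := by
  have hlam := hf.lam_pos
  refine intervalIntegral.intervalIntegral_pos_of_pos_on ?_
    (fun x hx ↦ isProlateFunction_pos_of_mem_Ioo hf hx) (by linarith)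
  exact (hf.contDiffOn.continuousOn.mono (by rw [uIcc_of_le (by linarith)])).intervalIntegrable

/-- `∫_0^λ h_λ = 0` for the Letter's guess built from ANY prolate pair, given uniqueness. -/
theorem integral_zero_lam_prolateGuessH_eq_zero' (hE : existsUnique_isProlateFunction) {f0 f4 : ℝ → ℝ}
    (h0 : IsProlateFunction lam 0 f0) (h4 : IsProlateFunction lam 4 f4) :
    ∫ t in (0 : ℝ)..lam, prolateGuessH lam f0 f4 t = 0 :=
  integral_zero_lam_prolateGuessH_eq_zero h0 h4 (isProlateFunction_even hE (by decide) h0)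
    (isProlateFunction_even hE (by decide) h4) (isProlateFunction_integral_pos h0).ne'

/-- The guess `h_λ` is measurable. -/
theorem measurable_prolateGuessH {f0 f4 : ℝ → ℝ} (h0 : IsProlateFunction lam 0 f0)
    (h4 : IsProlateFunction lam 4 f4) : Measurable (prolateGuessH lam f0 f4) := by
  unfold prolateGuessH
  exact measurable_const.mul ((isProlateFunction_measurable h4).sub
    (measurable_const.mul (isProlateFunction_measurable h0)))

end Prolate

/-! ## §E The raw prolate witness and its Mellin transform at the zeros -/

/-- **Connes's guess in the additive variable**: `k₀(t) = 𝓔(h_λ)(e^t)` for `e^t ∈ [λ⁻¹, λ]`, else `0`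
(`k_λ = 𝓔(h_λ)|[λ⁻¹,λ]`, Letter (6.6), transported by `u = e^t`). -/
def leakRaw (lam : ℝ) (f0 f4 : ℝ → ℝ) (t : ℝ) : ℂ :=
  (((Icc (1 / lam) lam).indicator (connesE (prolateGuessH lam f0 f4)) (Real.exp t) : ℝ) : ℂ)

/-- `k₀` vanishes for `|t| > log λ`. -/
theorem leakRaw_eq_zero {lam : ℝ} (hlam : 0 < lam) (f0 f4 : ℝ → ℝ) {t : ℝ} (ht : Real.log lam < |t|) :
    leakRaw lam f0 f4 t = 0 := by
  unfold leakRaw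
  rw [indicator_of_notMem, Complex.ofReal_zero]
  intro h
  rw [mem_Icc] at h
  rcases le_or_gt 0 t with ht0 | ht0
  · rw [abs_of_nonneg ht0] at ht
    have : lam < Real.exp t := by
      calc lam = Real.exp (Real.log lam) := (Real.exp_log hlam).symm
        _ < Real.exp t := Real.exp_lt_exp.2 ht
    linarith [h.2]
  · rw [abs_of_neg ht0] at ht
    have : Real.exp t < 1 / lam := by
      calc Real.exp t < Real.exp (-Real.log lam) := Real.exp_lt_exp.2 (by linarith)
        _ = 1 / lam := by rw [Real.exp_neg, Real.exp_log hlam, one_div]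
    linarith [h.1]

/-- `tsupport k₀ ⊆ [−log λ, log λ]`. -/
theorem tsupport_leakRaw_subset {lam : ℝ} (hlam : 0 < lam) (f0 f4 : ℝ → ℝ) :
    tsupport (leakRaw lam f0 f4) ⊆ Icc (-Real.log lam) (Real.log lam) := by
  refine closure_minimal (fun t ht ↦ ?_) isClosed_Icc
  rw [mem_Icc, ← abs_le]
  by_contra h
  exact ht (leakRaw_eq_zero hlam f0 f4 (not_le.1 h))

/-- `k₀` has compact support. -/
theorem hasCompactSupport_leakRaw {lam : ℝ} (hlam : 0 < lam) (f0 f4 : ℝ → ℝ) :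
    HasCompactSupport (leakRaw lam f0 f4) :=
  HasCompactSupport.of_support_subset_isCompact isCompact_Icc
    ((subset_tsupport _).trans (tsupport_leakRaw_subset hlam f0 f4))

/-- **`k̂₀(s) = M_λ(s − ½)`**: the tree's `weilMellin` of the transported guess is Connes's truncated Mellin
transform `prolateGuessMellin` (substitution `u = e^t`). -/
theorem weilMellin_leakRaw {lam : ℝ} (hlam : 0 < lam) (f0 f4 : ℝ → ℝ) (s : ℂ) :
    weilMellin (leakRaw lam f0 f4) s = prolateGuessMellin lam f0 f4 (s - 1 / 2) := by
  set h := prolateGuessH lam f0 f4 with hh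
  set G : ℝ → ℂ := fun u ↦
    (((Icc (1 / lam) lam).indicator (connesE h) u : ℝ) : ℂ) * (u : ℂ) ^ (s - 1 / 2 - 1) with hG
  have hzero : ∀ u ∉ Ioi (0 : ℝ), G u = 0 := fun u hu ↦ by
    have : u ∉ Icc (1 / lam) lam := fun h' ↦ hu (lt_of_lt_of_le (one_div_pos.2 hlam) h'.1)
    simp only [hG]
    rw [indicator_of_notMem this, Complex.ofReal_zero, zero_mul]
  have hR : prolateGuessMellin lam f0 f4 (s - 1 / 2) = ∫ u in Ioi 0, G u := by
    unfold prolateGuessMellin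
    rw [← integral_indicator measurableSet_Icc, setIntegral_eq_integral_of_forall_compl_eq_zero hzero]
    congr 1 with u
    simp only [hG, hh]
    by_cases hu : u ∈ Icc (1 / lam) lam
    · rw [indicator_of_mem hu, indicator_of_mem hu]
    · rw [indicator_of_notMem hu, indicator_of_notMem hu, Complex.ofReal_zero, zero_mul]
  rw [hR]
  have himage : Real.exp '' univ = Ioi (0 : ℝ) := by rw [image_univ, Real.range_exp]
  rw [← himage, integral_image_eq_integral_abs_deriv_smul MeasurableSet.univ
      (fun x _ ↦ (Real.hasDerivAt_exp x).hasDerivWithinAt) Real.exp_injective.injOn,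
    Measure.restrict_univ]
  unfold weilMellin
  refine integral_congr_ae (Eventually.of_forall fun t ↦ ?_)
  have hcpow : cexp (t : ℂ) ^ (s - 1 / 2 - 1) = cexp ((s - 1 / 2 - 1) * t) := by
    rw [Complex.cpow_def_of_ne_zero (Complex.exp_ne_zero _),
      Complex.log_exp (by rw [Complex.ofReal_im]; linarith [Real.pi_pos])
        (by rw [Complex.ofReal_im]; exact Real.pi_pos.le), mul_comm]
  simp only [leakRaw, hG, ← hh, Complex.real_smul, abs_of_pos (Real.exp_pos t), Complex.ofReal_exp]
  rw [hcpow]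
  have e1 : cexp ((s - 1 / 2) * (t : ℂ)) = cexp (t : ℂ) * cexp ((s - 1 / 2 - 1) * (t : ℂ)) := by
    rw [← Complex.exp_add]; congr 1; ring
  rw [e1]; ring

/-- **At a zero only the leak survives**: for `ρ` a non-trivial zero (on the line or not),
`k̂₀(ρ) = −∫_{(0,λ⁻¹]} 𝓔(h_λ)(u) u^{ρ − 3/2} du` — the main term `ζ(ρ)·𝓜h_λ(ρ)` of the truncation
identity `prolateGuessMellin_eq` vanishes. -/
theorem weilMellin_leakRaw_eq_of_zero (hE : existsUnique_isProlateFunction) {lam : ℝ} {f0 f4 : ℝ → ℝ}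
    (h0 : IsProlateFunction lam 0 f0) (h4 : IsProlateFunction lam 4 f4)
    {ρ : ℂ} (hρ : ρ ∈ ZetaZeros.riemannZetaNontrivialZeros) :
    weilMellin (leakRaw lam f0 f4) ρ =
      -∫ u in Ioc 0 (1 / lam), (connesE (prolateGuessH lam f0 f4) u : ℂ) * (u : ℂ) ^ (ρ - 1 / 2 - 1) := by
  have hint := integral_zero_lam_prolateGuessH_eq_zero' hE h0 h4
  have hs : -(1 / 2 : ℝ) < (ρ - 1 / 2).re := by
    simp only [sub_re, one_div]
    have := ZetaZeros.riemannZetaNontrivialZeros.re_pos hρ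
    norm_num at this ⊢; linarith
  have hs1 : ρ - 1 / 2 ≠ 1 / 2 := fun h ↦ ZetaZeros.riemannZetaNontrivialZeros.ne_one hρ (by
    linear_combination h)
  rw [weilMellin_leakRaw h0.lam_pos, prolateGuessMellin_eq h0 h4 hint hs hs1,
    show ρ - 1 / 2 + 1 / 2 = ρ by ring_nf, ZetaZeros.riemannZetaNontrivialZeros.zeta_eq_zero hρ,
    zero_mul, zero_sub]

/-- **The unconditional leak bound at a zero**: `‖k̂₀(ρ)‖ ≤ ∫_{(0,λ⁻¹]} |𝓔(h_λ)(u)| u^{Re ρ − 3/2} du`. -/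
theorem norm_weilMellin_leakRaw_le_integral (hE : existsUnique_isProlateFunction) {lam : ℝ}
    {f0 f4 : ℝ → ℝ} (h0 : IsProlateFunction lam 0 f0) (h4 : IsProlateFunction lam 4 f4)
    {ρ : ℂ} (hρ : ρ ∈ ZetaZeros.riemannZetaNontrivialZeros) :
    ‖weilMellin (leakRaw lam f0 f4) ρ‖ ≤
      ∫ u in Ioc 0 (1 / lam), |connesE (prolateGuessH lam f0 f4) u| * u ^ (ρ.re - 3 / 2) := by
  rw [weilMellin_leakRaw_eq_of_zero hE h0 h4 hρ, norm_neg]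
  refine (norm_integral_le_integral_norm _).trans (le_of_eq ?_)
  refine setIntegral_congr_fun measurableSet_Ioc fun u hu ↦ ?_
  rw [norm_mul, Complex.norm_real, Real.norm_eq_abs, Complex.norm_cpow_eq_rpow_re_of_pos hu.1]
  congr 1
  simp only [sub_re, one_re, div_ofNat_re]
  ring

/-! ## §F The one prolate input (typed, RH-free) and the leak bound it gives -/

/-- **HYPOTHESIS (H-LEAK-L1) — the prolate leak below the window, `L¹` form.**  For integers `N = λ² ≥ Λ`,
every prolate pair `h_{0,λ}, h_{4,λ}` and every `0 < β ≤ 1`: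
`β · ∫_{(0, λ⁻¹]} |𝓔(h_λ)(u)| u^{β − 3/2} du ≤ A · N^p · e^{−2πN}`.
Content: `𝓔(h_λ)(u)/√u = S_λ(u) = Σ_{n≥1} h_λ(nu)` is, for `u < λ⁻¹`, a Riemann sum of step `u` finer than the
Nyquist rate of the band-limited prolate functions, hence (Poisson duality) `−h_λ(0)/2` plus the OUTSIDE
sample sum of their entire extensions, all super-exponentially small.  STATUS: a statement about prolate
spheroidal functions ONLY — no zeta, no RH; NOT proved in this file.  Proved ON PAPER (not formalised) in the
`sup` form `sup_{0<u<1/λ} |S_λ(u)| ≤ Σ*_λ`, `Σ*_λ ≍ 10⁴ λ⁹ e^{−2πλ²}`, `Σ*_λ ≤ 10⁻¹⁹ (λ² ≥ 13)`, by the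
connes-x13 bundle (PROOF-ATTEMPT.md §3.6 THEOREM E′, P1STAR-PROOF Cor. 11; "mod I1–I3" = three cited
classical inputs), which gives this hypothesis with `p = 9/2` (`β ∫₀^{1/λ} √u Σ* u^{β−3/2} du = Σ* λ^{−β} ≤ Σ*`).
The `β`-weighted `L¹` form is weaker than the `sup` form and immune to a logarithmic edge singularity of the
Riemann sum at `u → λ⁻¹`.  The SHARP exponent `p` is open (the bundle's DATA: `Σ*_λ / sup|S_λ| ≈ 5·10², 9·10²,
3·10³` at `λ² = 8, 13, 20`).  Tagged `@[conjecture]` = open obligation node of the tree (paper-proved, unformalised). -/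
@[conjecture] def ProlateLeakL1 (A p Λ : ℝ) : Prop :=
  ∀ N : ℕ, Λ ≤ (N : ℝ) → ∀ f0 f4 : ℝ → ℝ,
    IsProlateFunction (Real.sqrt N) 0 f0 → IsProlateFunction (Real.sqrt N) 4 f4 →
    ∀ β : ℝ, 0 < β → β ≤ 1 →
      β * ∫ u in Ioc 0 (1 / Real.sqrt N), |connesE (prolateGuessH (Real.sqrt N) f0 f4) u| * u ^ (β - 3 / 2)
        ≤ A * (N : ℝ) ^ p * Real.exp (-(2 * Real.pi * N))

/-- **Leak bound at the zeros from (H-LEAK-L1)**: for integer `N = λ² ≥ Λ` and every non-trivial zero,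
`‖k̂₀(ρ)‖ ≤ A N^p e^{−2πN} / Re ρ`.  (With §C: `≤ A N^p e^{−2πN} · log(|γ|+4)/c₀`.) -/
theorem norm_weilMellin_leakRaw_le (hE : existsUnique_isProlateFunction) {A p Λ : ℝ}
    (hL : ProlateLeakL1 A p Λ) {N : ℕ} (hN : Λ ≤ (N : ℝ)) {f0 f4 : ℝ → ℝ}
    (h0 : IsProlateFunction (Real.sqrt N) 0 f0) (h4 : IsProlateFunction (Real.sqrt N) 4 f4)
    {ρ : ℂ} (hρ : ρ ∈ ZetaZeros.riemannZetaNontrivialZeros) :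
    ‖weilMellin (leakRaw (Real.sqrt N) f0 f4) ρ‖ ≤
      A * (N : ℝ) ^ p * Real.exp (-(2 * Real.pi * N)) / ρ.re := by
  have hre := ZetaZeros.riemannZetaNontrivialZeros.re_pos hρ
  have hre1 := ZetaZeros.riemannZetaNontrivialZeros.re_lt_one hρ
  have h1 := norm_weilMellin_leakRaw_le_integral hE h0 h4 hρ
  have h2 := hL N hN f0 f4 h0 h4 ρ.re hre hre1.le
  rw [le_div_iff₀ hre]
  calc ‖weilMellin (leakRaw (Real.sqrt N) f0 f4) ρ‖ * ρ.re
      ≤ (∫ u in Ioc 0 (1 / Real.sqrt N), |connesE (prolateGuessH (Real.sqrt N) f0 f4) u| *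
          u ^ (ρ.re - 3 / 2)) * ρ.re := mul_le_mul_of_nonneg_right h1 hre.le
    _ = ρ.re * ∫ u in Ioc 0 (1 / Real.sqrt N), |connesE (prolateGuessH (Real.sqrt N) f0 f4) u| *
          u ^ (ρ.re - 3 / 2) := mul_comm _ _
    _ ≤ A * (N : ℝ) ^ p * Real.exp (-(2 * Real.pi * N)) := h2

/-- The same with the zero-free region folded in: `‖k̂₀(ρ)‖ ≤ (A/c₀) N^p e^{−2πN} log(|γ| + 4)`. -/
theorem norm_weilMellin_leakRaw_le_log (hE : existsUnique_isProlateFunction) {A p Λ : ℝ} (hA : 0 ≤ A)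
    (hL : ProlateLeakL1 A p Λ) :
    ∃ c₀ : ℝ, 0 < c₀ ∧ ∀ N : ℕ, Λ ≤ (N : ℝ) → ∀ f0 f4 : ℝ → ℝ,
      IsProlateFunction (Real.sqrt N) 0 f0 → IsProlateFunction (Real.sqrt N) 4 f4 →
      ∀ ρ ∈ ZetaZeros.riemannZetaNontrivialZeros,
        ‖weilMellin (leakRaw (Real.sqrt N) f0 f4) ρ‖ ≤
          A / c₀ * (N : ℝ) ^ p * Real.exp (-(2 * Real.pi * N)) * Real.log (|ρ.im| + 4) := by
  obtain ⟨c₀, hc₀, hc⟩ := exists_div_log_le_re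
  refine ⟨c₀, hc₀, fun N hN f0 f4 h0 h4 ρ hρ ↦ (norm_weilMellin_leakRaw_le hE hL hN h0 h4 hρ).trans ?_⟩
  have hre := ZetaZeros.riemannZetaNontrivialZeros.re_pos hρ
  have hlog : 0 < Real.log (|ρ.im| + 4) := Real.log_pos (by linarith [abs_nonneg ρ.im])
  have hX : 0 ≤ A * (N : ℝ) ^ p * Real.exp (-(2 * Real.pi * N)) :=
    mul_nonneg (mul_nonneg hA (Real.rpow_nonneg (Nat.cast_nonneg N) _)) (Real.exp_pos _).le
  have h1 := (hc ρ hρ).1   -- c₀ / log ≤ Re ρ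
  calc A * (N : ℝ) ^ p * Real.exp (-(2 * Real.pi * N)) / ρ.re
      ≤ A * (N : ℝ) ^ p * Real.exp (-(2 * Real.pi * N)) / (c₀ / Real.log (|ρ.im| + 4)) :=
        div_le_div_of_nonneg_left hX (by positivity) h1
    _ = A / c₀ * (N : ℝ) ^ p * Real.exp (-(2 * Real.pi * N)) * Real.log (|ρ.im| + 4) := by
        field_simp

end Summit.RiemannHypothesis.RiemannHypothesis.Theorems.PfPersistenceM2Leak
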